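import Mathlib.NumberTheory.Padics.Hensel
import Mathlib.NumberTheory.Padics.RingHoms
import Mathlib.NumberTheory.Zsqrtd.QuadraticReciprocity
import HarnessLib

/-!
# A square root of `-1` in `ℤ_p` exists iff `p ≡ 1 (mod 4)` (odd `p`)

`Literature/NumberTheory/LocalFields/PadicSquareRootMinusOne.lean`. Gouvêa, *p-adic Numbers*
(1993), §4.6 "Hensel's lemma … two nice applications": Prop. 4.6.1 (a primitive `m`-th root of unity
lies in `ℚ_p`, `p ∤ m`, iff `m ∣ p − 1`) and Prop. 4.6.2 (`p ≠ 2`: a `p`-adic unit which is a square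
mod `p` is a square in `ℤ_p^×`), with Problem 24 (`X² + 1 = 0` is solvable in `ℚ₅`, not in `ℚ₇`).
We prove the case `m = 4` / `b = -1`: for a prime `p ≡ 1 (mod 4)` there is `ι ∈ ℤ_p` (hence in
`ℚ_p`) with `ι² = -1` (Hensel lift of a root of `X² + 1` mod `p`, which exists iff `p % 4 ≠ 3`,
Mathlib `ZMod.exists_sq_eq_neg_one_iff`), and for `p ≡ 3 (mod 4)` there is none (reduce mod `p`;
in `ℚ_p` a square root of `-1` is automatically a unit). Used by the abc cell's route
`PadicPrimesYuNinety` (crux at `p ≡ 1 (mod 4)`: Stewart–Yu's field `ℚ(i)` realised inside `ℚ_p`).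
Not here: `p = 2` (no `√-1` in `ℚ₂`; needs reduction mod `4`).

## References
* [Gouvea1993PadicNumbers] F. Q. Gouvêa, *p-adic Numbers: An Introduction*, Universitext, Springer
  1993 — §4.6, Prop. 4.6.1, Prop. 4.6.2, Problem 24.
-/

noncomputable section

open Polynomial

namespace Literature.NumberTheory.LocalFields

variable {p : ℕ} [Fact p.Prime]

/-- **Gouvêa, Prop. 4.6.2 (case `b = -1`) / Prop. 4.6.1 (case `m = 4`):** for a prime
`p ≡ 1 (mod 4)` there is a `p`-adic integer `ι` with `ι² = -1` (Hensel's lemma for `X² + 1` at a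
lift of a square root of `-1` mod `p`). [cite: Gouvea1993PadicNumbers, Prop. 4.6.2 (§4.6)] -/
theorem padicInt_exists_sq_eq_neg_one (hp : p % 4 = 1) : ∃ ι : ℤ_[p], ι ^ 2 = -1 := by
  have hp2 : p ≠ 2 := by intro h; rw [h] at hp; norm_num at hp
  -- a square root of `-1` mod `p`
  obtain ⟨r, hr⟩ := ZMod.exists_sq_eq_neg_one_iff.mpr (by omega : p % 4 ≠ 3)
  -- lift it to `ℤ_[p]`
  set a : ℤ_[p] := ((r.val : ℕ) : ℤ_[p]) with ha
  have har : PadicInt.toZMod a = r := by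
    rw [ha, map_natCast, ZMod.natCast_zmod_val]
  set F : Polynomial ℤ_[p] := X ^ 2 + 1 with hF
  have hFa : F.aeval a = a ^ 2 + 1 := by simp [hF]
  have hF'a : F.derivative.aeval a = 2 * a := by
    rw [hF]
    simp only [derivative_add, derivative_X_pow, derivative_one, add_zero, map_mul, map_pow,
      aeval_X, map_natCast]
    norm_num
  -- `F(a)` is in the maximal ideal
  have hsmall : ‖F.aeval a‖ < 1 := by
    rw [hFa, ← PadicInt.mem_nonunits, ← IsLocalRing.mem_maximalIdeal, ← PadicInt.ker_toZMod,
      RingHom.mem_ker, map_add, map_pow, har, map_one, sq, ← hr, neg_add_cancel]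
  -- `F'(a) = 2a` is a unit
  have hr0 : r ≠ 0 := by
    rintro rfl
    rw [mul_zero] at hr
    exact neg_ne_zero.mpr one_ne_zero hr
  have h20 : (2 : ZMod p) ≠ 0 := by
    intro h
    have h' : ((2 : ℕ) : ZMod p) = 0 := by exact_mod_cast h
    rw [ZMod.natCast_eq_zero_iff] at h'
    exact hp2 ((Nat.prime_dvd_prime_iff_eq (Fact.out) Nat.prime_two).mp h')
  have hunit : ‖F.derivative.aeval a‖ = 1 := by
    rw [hF'a]
    by_contra hne
    have hlt : ‖(2 : ℤ_[p]) * a‖ < 1 := lt_of_le_of_ne (PadicInt.norm_le_one _) hne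
    rw [← PadicInt.mem_nonunits, ← IsLocalRing.mem_maximalIdeal, ← PadicInt.ker_toZMod,
      RingHom.mem_ker, map_mul, har, map_ofNat] at hlt
    exact mul_ne_zero h20 hr0 hlt
  have hnorm : ‖F.aeval a‖ < ‖F.derivative.aeval a‖ ^ 2 := by
    rw [hunit, one_pow]; exact hsmall
  obtain ⟨z, hz, -⟩ := hensels_lemma hnorm
  refine ⟨z, ?_⟩
  have : z ^ 2 + 1 = 0 := by simpa [hF] using hz
  linear_combination this

/-- The same in `ℚ_p`: for `p ≡ 1 (mod 4)` there is `ι ∈ ℚ_p` with `ι² = -1`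
("`X² + 1 = 0` has a solution in `ℚ₅`"). [cite: Gouvea1993PadicNumbers, Prop. 4.6.1 (§4.6), Problem 24] -/
theorem padic_exists_sq_eq_neg_one (hp : p % 4 = 1) : ∃ ι : ℚ_[p], ι ^ 2 = -1 := by
  obtain ⟨ι, hι⟩ := padicInt_exists_sq_eq_neg_one hp
  refine ⟨(ι : ℚ_[p]), ?_⟩
  rw [← PadicInt.coe_pow, hι]
  simp

/-- **Converse (odd `p`):** if `p ≡ 3 (mod 4)` then `-1` is not a square in `ℤ_p` (reduce mod
`p`: `-1` is a square mod `p` iff `p % 4 ≠ 3`). [cite: Gouvea1993PadicNumbers, Prop. 4.6.1 (§4.6), Problem 24] -/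
theorem padicInt_sq_ne_neg_one (hp : p % 4 = 3) (ι : ℤ_[p]) : ι ^ 2 ≠ -1 := by
  intro h
  have hsq : IsSquare (-1 : ZMod p) := by
    refine ⟨PadicInt.toZMod ι, ?_⟩
    rw [← sq, ← map_pow, h, map_neg, map_one]
  exact ZMod.exists_sq_eq_neg_one_iff.mp hsq hp

/-- … nor in `ℚ_p` ("`X² + 1 = 0` has no solution in `ℚ₇`"): a square root of `-1` in `ℚ_p` has
norm `1`, hence lies in `ℤ_p`. [cite: Gouvea1993PadicNumbers, Prop. 4.6.1 (§4.6), Problem 24] -/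
theorem padic_sq_ne_neg_one (hp : p % 4 = 3) (ι : ℚ_[p]) : ι ^ 2 ≠ -1 := by
  intro h
  have hnorm : ‖ι‖ ≤ 1 := by
    have h1 : ‖ι‖ ^ 2 = 1 := by rw [← norm_pow, h, norm_neg, norm_one]
    nlinarith [norm_nonneg ι]
  have := padicInt_sq_ne_neg_one hp ⟨ι, hnorm⟩
  apply this
  apply Subtype.ext
  simp only [PadicInt.coe_pow, PadicInt.coe_neg, PadicInt.coe_one]
  exact h

end Literature.NumberTheory.LocalFields

end
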